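import Literature.AlgebraicGeometry.Resolution.QuadraticTransformColength
import Literature.AlgebraicGeometry.Resolution.NearPointsChart
import Literature.AlgebraicGeometry.Resolution.RsopMonomialIdeals
import Literature.AlgebraicGeometry.Resolution.PointBlowupOrder
import HarnessLib

/-!
# At a near point over a two-dimensional point the colength of the weak transform drops

Topic: `Literature/AlgebraicGeometry/Resolution`. [CoP1] = Cossart–Piltant, J. Algebra 320
(2008), proof of Prop. 4.4, p. 10: "Working above the generic point `η(i)` of some one dimensional
component of `Σ(i)`, we have `J𝒪_{X(i),η(i)}` principal for `i >> 0` (this is a consequence of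
[47] appendix 5, theorem 3 and (E) on p. 391); hence `n(i)` eventually drops." Here
`R = 𝒪_{X(i),η(i)}` is a two-dimensional regular local ring, `J = J_{η(i)}` is `𝔪`-primary of
order `r = μ`, the blowing up of the curve induces the blowing up of the closed point of
`Spec R`, and a curve of `Σ(i+1)` mapping onto the curve has its generic point at a NEAR point
of that blowing up (`ord J′ = r`). PROVED, the ring-level statement: **at a near prime `𝔴` of
the chart `B_j = R[𝔪/c_j]` the colength of the weak transform `J′ = (J B_j : c_j^r)` is smaller
than that of `J`: `λ_{B_j}(B_j/J′) < λ_R(R/J)`** — so chains of near points over `η(i)` are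
finite. By `NearPointsChart.lean` all initial forms of degree `r` of `J` are
`c_F (Y_l − a Y_j)^r`; an `f ∈ J` of order `r` therefore has `f ∉ (c_j) + 𝔪^{r+1}` (its
initial form is not divisible by `Y_j`), and `QuadraticTransformColength.lean`
(Huneke–Swanson 14.3.4) applies with `x = c_j`.

* `chartBase_injective`, `exists_pow_mul_eq_chartBase` — the chart `B_j` of the blowing up of
  the closed point satisfies the hypotheses of `QuadraticTransformColength.lean`;
* `not_mem_span_sup_pow_of_map_residue_eq` — an element whose initial form is
  `c₀ (Y_l − a Y_j)^r`, `c₀ ≠ 0`, does not lie in `(c_j) + 𝔪^{r+1}`;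
* `length_quotient_weakTransform_lt_of_near` — **the theorem.**

## Sources

* V. Cossart, O. Piltant, J. Algebra 320 (2008) 1051–1082, proof of Prop. 4.4, p. 10.
  [CossartPiltant2008]
* C. Huneke, I. Swanson, *Integral Closure of Ideals, Rings, and Modules* (2006), Lemma 14.3.4.
  [HunekeSwanson2006]
* O. Zariski, P. Samuel, *Commutative Algebra* II (1960), Appendix 5. [ZariskiSamuel1960]
-/

noncomputable section

open IsLocalRing MvPolynomial

namespace Literature.AlgebraicGeometry.Resolution

universe u

section Chart

variable {R : Type u} [CommRing R] [IsRegularLocalRing R]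
  (hd : (maximalIdeal R).spanFinrank = 2) (c : Fin 2 → R)
  (hc : Ideal.span (Set.range c) = maximalIdeal R) (j : Fin 2)

/-- The structure map `R → B_j` of a chart of the blowing up of a non-zero ideal of a domain is
injective. [folklore] -/
theorem chartBase_injective {k : ℕ} (c : Fin k → R) (j : Fin k) (hcj : c j ≠ 0) :
    Function.Injective (chartBase c j) := by
  haveI := isDomain_of_isRegularLocalRing R
  intro r₁ r₂ h
  have h' := congrArg (reesChart (c j) (Ideal.mem_span_range_self (f := c) (x := j))) h
  rw [reesChart_reesChartBase, reesChart_reesChartBase] at h'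
  exact IsLocalization.injective (M := Submonoid.powers (c j)) (Localization.Away (c j))
    (powers_le_nonZeroDivisors_of_noZeroDivisors hcj) h'

include hc in
/-- Every element `s` of the chart `B_j = R[𝔪/c_j]` has `c_j^n s ∈ 𝔪^n` for some `n`
(`s = F(e)` for a form `F` of degree `n`, and `c_j^n F(e) = F(c)`). [folklore] -/
theorem exists_pow_mul_eq_chartBase (s : chartRing c j) :
    ∃ (n : ℕ) (b : R), b ∈ maximalIdeal R ^ n ∧ chartBase c j b = chartBase c j (c j) ^ n * s := by
  obtain ⟨n, F, hF, hFs⟩ := exists_isHomogeneous_eval₂_eq c j s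
  refine ⟨n, MvPolynomial.eval c F, ?_, ?_⟩
  · rw [← hc]
    exact eval_mem_span_pow c hF
  · rw [← hFs]
    exact reesChartBase_eval_eq_pow_mul_eval₂ c j hF

set_option maxHeartbeats 400000 in
include hd hc in
/-- **An element whose initial form is `c₀ (Y_l − a Y_j)^r`, `c₀ ≠ 0`, does not lie in
`(c_j) + 𝔪^{r+1}`** (its initial form would be divisible by `Y_j`). [folklore] -/
theorem not_mem_span_sup_pow_of_map_residue_eq {l : Fin 2} (hl : l ≠ j) {F : MvPolynomial (Fin 2) R}
    {r : ℕ} (hF : F.IsHomogeneous r) {a c₀ : ResidueField R} (hc₀ : c₀ ≠ 0)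
    (hFbar : MvPolynomial.map (residue R) F = C c₀ * (X l - C a * X j) ^ r) :
    MvPolynomial.eval c F ∉ Ideal.span {c j} ⊔ maximalIdeal R ^ (r + 1) := by
  classical
  intro hmem
  obtain ⟨g', hg', h, hh, hgh⟩ := Submodule.mem_sup.mp hmem
  obtain ⟨g, rfl⟩ := Ideal.mem_span_singleton'.mp hg'
  have hrsop : IsRsopPart c :=
    isRsopPart_comp_of_rsop hd c hc id Function.injective_id
  have hcj2 : c j ∉ maximalIdeal R ^ 2 := hrsop.not_mem_sq j
  rcases Nat.eq_zero_or_pos r with hr0 | hrpos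
  · -- `r = 0`: `F(c) ∈ (c_j) + 𝔪 = 𝔪`, but `F̄ = c₀ ≠ 0`
    subst hr0
    have hFm : MvPolynomial.eval c F ∈ maximalIdeal R ^ (0 + 1) := by
      rw [zero_add, pow_one, ← hgh]
      rw [zero_add, pow_one] at hh
      refine add_mem (Ideal.mul_mem_left _ _ ?_) hh
      rw [← hc]
      exact Ideal.subset_span ⟨j, rfl⟩
    have h0 : MvPolynomial.map (residue R) F = 0 :=
      map_residue_eq_zero_of_eval_mem_pow_succ hd c hc hF hFm
    rw [hFbar, pow_zero, mul_one, C_eq_zero] at h0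
    exact hc₀ h0
  -- `r ≥ 1`: `g c_j ∈ 𝔪^r`, so `g ∈ 𝔪^{r-1}` is `G₀(c)` for a form of degree `r - 1`
  have hgcj : g * c j ∈ maximalIdeal R ^ r := by
    have h1 : g * c j = MvPolynomial.eval c F - h := by rw [← hgh]; ring
    rw [h1]
    refine sub_mem ?_ (Ideal.pow_le_pow_right (Nat.le_succ r) hh)
    rw [← hc]
    exact eval_mem_span_pow c hF
  have hg : g ∈ maximalIdeal R ^ (r - 1) := by
    by_contra hnot
    rcases Nat.lt_or_ge r 2 with hr2 | hr2
    · obtain rfl : r = 1 := by omega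
      exact hnot (by rw [Nat.sub_self, pow_zero, Ideal.one_eq_top]; trivial)
    · have h1 : g ∉ maximalIdeal R ^ ((r - 2) + 1) := by
        rwa [show r - 2 + 1 = r - 1 by omega]
      have h2 := mul_not_mem_pow_of_not_mem_pow h1 (hcj2 : c j ∉ maximalIdeal R ^ (1 + 1))
      rw [show r - 2 + 1 + 1 = r by omega] at h2
      exact h2 hgcj
  obtain ⟨G₀, hG₀, hG₀g⟩ : ∃ G₀ : MvPolynomial (Fin 2) R, G₀.IsHomogeneous (r - 1) ∧
      MvPolynomial.eval c G₀ = g := by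
    have : g ∈ Ideal.span (Set.range c) ^ (r - 1) := by rw [hc]; exact hg
    exact exists_isHomogeneous_of_mem_span_pow c (r - 1) this
  -- `F(c) - (X_j G₀)(c) = h ∈ 𝔪^{r+1}`, so `F̄ = Y_j Ḡ₀`
  have hXG : (X j * G₀ : MvPolynomial (Fin 2) R).IsHomogeneous r := by
    have := (isHomogeneous_X R j).mul hG₀
    rwa [show 1 + (r - 1) = r by omega] at this
  have hdiff : MvPolynomial.map (residue R) (F - X j * G₀) = 0 := by
    refine map_residue_eq_zero_of_eval_mem_pow_succ hd c hc (hF.sub hXG) ?_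
    have : MvPolynomial.eval c (F - X j * G₀) = h := by
      rw [map_sub, map_mul, MvPolynomial.eval_X, hG₀g, ← hgh]
      ring
    rw [this]
    exact hh
  rw [map_sub, sub_eq_zero, hFbar, map_mul, MvPolynomial.map_X] at hdiff
  -- evaluate at `Y_j = 0`, `Y_l = 1`: `c₀ = 0`
  have hev := congrArg (MvPolynomial.eval (Function.update (fun _ => (0 : ResidueField R)) l 1)) hdiff
  simp only [map_mul, map_pow, map_sub, eval_C, eval_X, Function.update_self,
    Function.update_of_ne (Ne.symm hl), mul_zero, sub_zero, one_pow, mul_one, zero_mul] at hev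
  exact hc₀ hev

set_option maxHeartbeats 400000 in
include hd hc in
/-- **[CoP1] Prop. 4.4, termination above the generic point of a curve ([47] App. 5): at a near
point of the blowing up of a two-dimensional point the colength of the weak transform drops.**
Let `R` be a two-dimensional regular local ring with regular system of parameters
`c = (c_0, c_1)`, `J ⊆ 𝔪^r` an ideal of order `r ≥ 1` (`J ⊄ 𝔪^{r+1}`) with `R/J` of finite
length, `B_j` the `j`-th chart of the blowing up of the closed point and `𝔴 ⊇ 𝔪 B_j` a prime
at which every weak transform `F(e)`, `F` a form of degree `r` with `F(c) ∈ J`, lies in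
`𝔴^r (B_j)_𝔴` (the point `𝔴` is near). Then the weak transform `J′ = (J B_j : c_j^r)` has
`λ_{B_j}(B_j/J′) < λ_R(R/J)`. [cite: CossartPiltant2008, proof of Prop. 4.4]
[cite: HunekeSwanson2006, Lemma 14.3.4] -/
theorem length_quotient_weakTransform_lt_of_near {J : Ideal R} {r : ℕ} (hr : 1 ≤ r)
    (hJ : J ≤ maximalIdeal R ^ r) (hJ' : ¬ J ≤ maximalIdeal R ^ (r + 1))
    (hfin : IsFiniteLength R (R ⧸ J)) (𝔴 : Ideal (chartRing c j)) [𝔴.IsPrime]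
    (h𝔴 : (maximalIdeal R).map (chartBase c j) ≤ 𝔴)
    (hnear : ∀ F : MvPolynomial (Fin 2) R, F.IsHomogeneous r → MvPolynomial.eval c F ∈ J →
      (algebraMap (chartRing c j) (Localization.AtPrime 𝔴) :
          chartRing c j →+* Localization.AtPrime 𝔴)
          (MvPolynomial.eval₂Hom (chartBase c j) (fun i => chartGen c j i) F) ∈
        maximalIdeal (Localization.AtPrime 𝔴) ^ r) :
    Module.length (chartRing c j)
        (chartRing c j ⧸ (J.map (chartBase c j)).colon {chartBase c j (c j) ^ r}) <
      Module.length R (R ⧸ J) := by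
  classical
  -- the chart satisfies the hypotheses of `QuadraticTransformColength`
  have hrsop : IsRsopPart c :=
    isRsopPart_comp_of_rsop hd c hc id Function.injective_id
  have hx1 : c j ∈ maximalIdeal R := hc ▸ Ideal.subset_span ⟨j, rfl⟩
  have hx2 : c j ∉ maximalIdeal R ^ 2 := hrsop.not_mem_sq j
  have hcj0 : c j ≠ 0 := fun h0 => hx2 (h0 ▸ zero_mem _)
  have hinj : Function.Injective (chartBase c j) := chartBase_injective c j hcj0
  have hxS : chartBase c j (c j) ∈ nonZeroDivisors (chartRing c j) :=
    reesChartBase_mem_nonZeroDivisors (c j) (Ideal.mem_span_range_self (f := c) (x := j))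
  have hmS : (maximalIdeal R).map (chartBase c j) = Ideal.span {chartBase c j (c j)} := by
    rw [← hc]
    exact Ideal.map_span_range_eq_span_singleton (chartBase c j) c j (fun i => chartGen c j i)
      (reesChartBase_apply_eq_mul_chartGen c j)
  have hS2 : ∀ s : chartRing c j, ∃ (n : ℕ) (b : R), b ∈ maximalIdeal R ^ n ∧
      chartBase c j b = chartBase c j (c j) ^ n * s :=
    exists_pow_mul_eq_chartBase c hc j
  letI : Algebra R (chartRing c j) := (chartBase c j).toAlgebra
  -- the other index and `𝔪 = (c_j, c_l)`
  obtain ⟨l, hl⟩ : ∃ l : Fin 2, l ≠ j := ⟨j + 1, by fin_cases j <;> decide⟩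
  have hxy : Ideal.span {c j, c l} = maximalIdeal R := by
    rw [← hc]
    congr 1
    ext z
    simp only [Set.mem_insert_iff, Set.mem_singleton_iff, Set.mem_range]
    constructor
    · rintro (rfl | rfl)
      exacts [⟨j, rfl⟩, ⟨l, rfl⟩]
    · rintro ⟨i, rfl⟩
      by_cases hij : i = j
      · exact Or.inl (by rw [hij])
      · right
        have : i = l := by
          apply Fin.ext
          have hi := i.isLt
          have hj := j.isLt
          have hl' := l.isLt
          have h1 : i.val ≠ j.val := fun h => hij (Fin.ext h)
          have h2 : l.val ≠ j.val := fun h => hl (Fin.ext h)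
          omega
        rw [this]
  -- an element `f = F(c) ∈ J` of order `r` with `F̄ = c₀ (Y_l − a Y_j)^r`, `c₀ ≠ 0`
  have hcq : IsQuasiRegular c := isQuasiRegular_regularSystemOfParameters hd c hc
  have hcm : ∀ i, c i ∈ maximalIdeal R := fun i => hc ▸ Ideal.subset_span ⟨i, rfl⟩
  obtain ⟨a, ha⟩ := exists_forall_map_residue_eq_C_mul_X_sub_C_mul_X_pow c j hl hcq hcm 𝔴 h𝔴 hr
    {F : MvPolynomial (Fin 2) R | F.IsHomogeneous r ∧ MvPolynomial.eval c F ∈ J}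
    (fun F hF => ⟨hF.1, hnear F hF.1 hF.2⟩)
  obtain ⟨f, hfJ, hf'⟩ := Set.not_subset.mp hJ'
  obtain ⟨F, hF, hFf⟩ := exists_isHomogeneous_of_mem_span_pow c r (by rw [hc]; exact hJ hfJ)
  have hF0 : MvPolynomial.map (residue R) F ≠ 0 :=
    map_residue_ne_zero_of_eval_not_mem_pow_succ c hcm hF (by rw [hFf]; exact hf')
  obtain ⟨c₀, hc₀F⟩ := ha F ⟨hF, by rw [hFf]; exact hfJ⟩
  have hc₀ : c₀ ≠ 0 := by
    rintro rfl
    exact hF0 (by rw [hc₀F, C_0, zero_mul])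
  have hfnot := not_mem_span_sup_pow_of_map_residue_eq hd c hc j hl hF hc₀ hc₀F
  rw [hFf] at hfnot
  exact length_quotient_transform_lt_of_not_mem (S := chartRing c j) hx1 hx2 hinj hxS hmS hS2 hxy hr
    hJ hfJ hfnot hfin

end Chart

end Literature.AlgebraicGeometry.Resolution

end
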